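import Summits.ResolutionOfSingularities.ResolutionOfSingularities.Theorems.WeightedInvariantIota3JSigmaPtMapOfExactIdealDescent
import HarnessLib

/-!
# The letter-form ideal descent (IDL-desc)₃ is the exact form (IDLexact)₃ plus the EXACTNESS of the ratio letter (R6) — a one-ring statement
# (door `HypersurfaceCentreConstruction`, stmt-ResolutionOfSingularities-19897; P3 rung; gaps (σ-ext)₃ / GAP 2)

Topic: `Summits/ResolutionOfSingularities/ResolutionOfSingularities/Theorems`. Helper for the door item `HypersurfaceCentreConstruction`
(stmt-ResolutionOfSingularities-19897, route `WeightedInvariant`), line `local-engine` (skeleton v3.12 `7a4b52ef`), def-free.  Sequel of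
`keyRungGrHomLE_three_of_idealDescentExact3` (…Iota3JSigmaPtMapOfExactIdealDescent, p820262), which carried the ideal-descent statement in two
forms: the LETTER form (IDL-desc)₃ (triples with `ν!·r₁ = σ₁(g)·r₂`, feeding (σ-ext)₃) and the EXACT form (IDLexact)₃ (triples whose ratio bounds
every upstairs reach, `r₁'·r₂ ≤ r₁·r₂'`, feeding GAP 2).  They differ exactly by the EXACTNESS OBLIGATION (R6) of …Iota3Sigma (design note: «that
the floors lose nothing is an OBLIGATION»), stated here on ONE ring, with no map:

  **(R6exact)₃** «`T` regular local of dimension three, `f ∈ 𝔪 ∖ 0`, `ν = ord f`: every admissible triple `(q; r₁, r₂)` reached by `f` has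
  `ν!·r₁ ≤ σ₁(f)·r₂`» (the scaled sup `σ₁ = sigmaRatioNat f` is an EXACT bound for the reached ratios — automatic when the maximal ratio is attained
  with denominator dividing `ν!`).

* `exactMax_of_letterMax` — under (R6exact) at `(T', φ g)` and the ratio tie `σ₁(φ g) = σ₁(g)` (tree, `JFlatEssSmooth.sigmaRatioNat_algebraMap_eq`),
  a triple with `ν!·r₁ = σ₁(g)·r₂` is exactly ratio-maximal upstairs;
* `idealDescent_letter_of_exact` — (IDL-desc)₃ ⟸ (IDLexact)₃ ∧ (R6exact)₃;
* **`keyRungGrHomLE_three_of_idealDescentExactR6`** — the gap list with FIVE hypotheses: (desc-τ), **(IDLexact)₃** (the ONE ideal-descent statement: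
  levels of upstairs two-flags carrying `φ g` to an exactly ratio-maximal triple with `q < r₂` are extended), **(R6exact)₃**, hgame, the residue of
  the dominance word at the power positions.

[OURS · L1 W4.3 · audit glue]  Replaces the role of NO printed item; NOT a statement of the manuscript [claim: Hironaka2017, status: under-review];
candidates stay candidates; AI work, weaker than expert review.  No definition; no axiom.
-/

noncomputable section

set_option linter.dupNamespace false -- mandated namespace `Summit.<Summit>.<Problem>` of this single-conjunct summit

open IsLocalRing Literature.AlgebraicGeometry.Resolution
open Summit.ResolutionOfSingularities.ResolutionOfSingularities.Theorems

namespace Summit.ResolutionOfSingularities.ResolutionOfSingularities.Cruxes.HypersurfaceCentreConstruction.LocalEngine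

namespace Iota3

section DimThree

variable {S S' : Type} [CommRing S] [CommRing S'] [IsRegularLocalRing S] [IsRegularLocalRing S'] [Algebra S S']
  [IsLocalHom (algebraMap S S')] [Algebra.FormallySmooth S S'] [Algebra.EssFiniteType S S']

/-- **Letter-maximal ⇒ exactly maximal, given exactness upstairs**: if every triple reached by `φ f` satisfies `ν!·r₁' ≤ σ₁(φ f)·r₂'`, then a
triple `(q; r₁, r₂)` with `ν!·r₁ = σ₁(f)·r₂` bounds every upstairs reach exactly (`σ₁(φ f) = σ₁(f)` at equal dimension three). [OURS · L1 W4.3] -/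
theorem exactMax_of_letterMax (h𝔪 : (maximalIdeal S).map (algebraMap S S') = maximalIdeal S')
    (hdim : ringKrullDim S = (3 : ℕ)) (hdim' : ringKrullDim S' = (3 : ℕ)) {f : S} (hf0 : f ≠ 0) (hf : f ∈ maximalIdeal S)
    (hR6 : ∀ q' r₁' r₂' : ℕ, AdmissibleTriple q' r₁' r₂' → FlagReaches (algebraMap S S' f) (adicOrder f).toNat q' r₁' r₂' →
      ratioScale (adicOrder f).toNat * r₁' ≤ sigmaRatioNat (algebraMap S S' f) * r₂')
    {r₁ r₂ : ℕ} (hratio : ratioScale (adicOrder f).toNat * r₁ = sigmaRatioNat f * r₂)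
    {q' r₁' r₂' : ℕ} (hadm' : AdmissibleTriple q' r₁' r₂') (hreach : FlagReaches (algebraMap S S' f) (adicOrder f).toNat q' r₁' r₂') :
    r₁' * r₂ ≤ r₁ * r₂' := by
  have hσ : sigmaRatioNat (algebraMap S S' f) = sigmaRatioNat f := JFlatEssSmooth.sigmaRatioNat_algebraMap_eq h𝔪 hdim hdim' hf0 hf
  have h1 := hR6 q' r₁' r₂' hadm' hreach
  rw [hσ] at h1
  have hν : 0 < ratioScale (adicOrder f).toNat := Nat.factorial_pos _
  refine Nat.le_of_mul_le_mul_left ?_ hν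
  calc ratioScale (adicOrder f).toNat * (r₁' * r₂) = (ratioScale (adicOrder f).toNat * r₁') * r₂ := by ring
    _ ≤ (sigmaRatioNat f * r₂') * r₂ := Nat.mul_le_mul_right _ h1
    _ = (sigmaRatioNat f * r₂) * r₂' := by ring
    _ = ratioScale (adicOrder f).toNat * (r₁ * r₂') := by rw [← hratio]; ring

end DimThree

/-- **(IDL-desc)₃ (letter form) ⟸ (IDLexact)₃ ∧ (R6exact)₃.** [OURS · L1 W4.3 · audit glue] -/
theorem idealDescent_letter_of_exact
    (hidlx : ∀ (T T' : Type) [CommRing T] [IsRegularLocalRing T] [CommRing T'] [IsRegularLocalRing T'] [Algebra T T']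
      [IsLocalHom (algebraMap T T')] [Algebra.FormallySmooth T T'] [Algebra.EssFiniteType T T'] (g : T),
      ringKrullDim T = (3 : ℕ) → ringKrullDim T' = (3 : ℕ) → (maximalIdeal T).map (algebraMap T T') = maximalIdeal T' →
      g ≠ 0 → g ∈ maximalIdeal T → ∀ (g₁' g₂' : T') (q r₁ r₂ : ℕ), IsTwoFlag g₁' g₂' → AdmissibleTriple q r₁ r₂ → q < r₂ →
      algebraMap T T' g ∈ flagContactFiltration g₁' g₂' q r₁ r₂ (r₁ * (adicOrder g).toNat) →
      (∀ q' r₁' r₂' : ℕ, AdmissibleTriple q' r₁' r₂' → FlagReaches (algebraMap T T' g) (adicOrder g).toNat q' r₁' r₂' →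
        r₁' * r₂ ≤ r₁ * r₂') →
      ∃ J₁ J₂ : Ideal T, J₁.map (algebraMap T T') = flagContactFiltration g₁' g₂' q r₁ r₂ r₁ ∧
        J₂.map (algebraMap T T') = flagContactFiltration g₁' g₂' q r₁ r₂ r₂)
    (hR6 : ∀ (T : Type) [CommRing T] [IsRegularLocalRing T] (f : T), ringKrullDim T = (3 : ℕ) → f ≠ 0 → f ∈ maximalIdeal T →
      ∀ q r₁ r₂ : ℕ, AdmissibleTriple q r₁ r₂ → FlagReaches f (adicOrder f).toNat q r₁ r₂ →
      ratioScale (adicOrder f).toNat * r₁ ≤ sigmaRatioNat f * r₂) :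
    ∀ (A A' : Type) [CommRing A] [IsRegularLocalRing A] [CommRing A'] [IsRegularLocalRing A'] [Algebra A A']
      [IsLocalHom (algebraMap A A')] [Algebra.FormallySmooth A A'] [Algebra.EssFiniteType A A'] (g : A),
      ringKrullDim A = (3 : ℕ) → ringKrullDim A' = (3 : ℕ) → (maximalIdeal A).map (algebraMap A A') = maximalIdeal A' →
      g ≠ 0 → g ∈ maximalIdeal A → ∀ q r₁ r₂ : ℕ, AdmissibleTriple q r₁ r₂ → q < r₂ →
      ratioScale (adicOrder g).toNat * r₁ = sigmaRatioNat g * r₂ →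
      ∀ g₁' g₂' : A', IsTwoFlag g₁' g₂' →
      algebraMap A A' g ∈ flagContactFiltration g₁' g₂' q r₁ r₂ (r₁ * (adicOrder g).toNat) →
      ∃ J₁ J₂ : Ideal A, J₁.map (algebraMap A A') = flagContactFiltration g₁' g₂' q r₁ r₂ r₁ ∧
        J₂.map (algebraMap A A') = flagContactFiltration g₁' g₂' q r₁ r₂ r₂ := by
  intro A A' _ _ _ _ _ _ _ _ g ha hb h𝔪 hg0 hg q r₁ r₂ hadm hq hratio g₁' g₂' hfl hmem
  haveI : Module.Flat A A' := IotaOrderEssSmooth.flat_of_formallySmooth_of_essFiniteType A A'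
  have hg0' : algebraMap A A' g ≠ 0 := fun h => hg0 (by
    have h1 := (mem_iff_algebraMap_mem_map_of_flat h𝔪 (⊥ : Ideal A) g).mpr (by rw [Ideal.map_bot, h]; exact Ideal.zero_mem _)
    exact (Submodule.mem_bot A).mp h1)
  have hg' : algebraMap A A' g ∈ maximalIdeal A' := h𝔪 ▸ Ideal.mem_map_of_mem _ hg
  have hν : (adicOrder (algebraMap A A' g)).toNat = (adicOrder g).toNat := by rw [adicOrder_algebraMap_eq_of_flat h𝔪]
  refine hidlx A A' g ha hb h𝔪 hg0 hg g₁' g₂' q r₁ r₂ hfl hadm hq hmem fun q' r₁' r₂' hadm' hreach => ?_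
  refine exactMax_of_letterMax h𝔪 ha hb hg0 hg (fun q'' r₁'' r₂'' hadm'' hreach'' => ?_) hratio hadm' hreach
  have h := hR6 A' (algebraMap A A' g) hb hg0' hg' q'' r₁'' r₂'' hadm'' (by rw [hν]; exact hreach'')
  rwa [hν] at h

end Iota3

/-! ## The gap list -/

open Iota3 in
/-- **P3 RUNG FOR THE NAMED PAIR MODULO FIVE HYPOTHESES, ONE IDEAL-DESCENT STATEMENT**: (desc-τ); **(IDLexact)₃** «along a 𝔪-preserving local
formally smooth e.f.t. `φ : A → A'` of regular local rings of dimension three, for `g ∈ 𝔪_A ∖ 0`, the levels `F'(r₁)`, `F'(r₂)` of every two-flag of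
`A'` carrying `φ g` to an admissible `(q; r₁, r₂)` with `q < r₂` whose ratio bounds every upstairs reach (`r₁'·r₂ ≤ r₁·r₂'`) are extended from `A`»;
**(R6exact)₃** «on a regular local ring of dimension three the scaled ratio letter bounds the reached ratios exactly: `ν!·r₁ ≤ σ₁(f)·r₂`»; hgame; the
residue of the dominance word at the power positions. [OURS · L1 W4.3 · audit glue] -/
theorem keyRungGrHomLE_three_of_idealDescentExactR6 (p : ℕ)
    (hD : ∀ (T T' : Type) [CommRing T] [IsRegularLocalRing T] [CommRing T'] [IsRegularLocalRing T'] [Algebra T T']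
      [IsLocalHom (algebraMap T T')] [Algebra.FormallySmooth T T'] [Algebra.EssFiniteType T T'] (g : T),
      ringKrullDim T' ≤ 3 → IsTiePosition T' (algebraMap T T' g) → IsTiePosition T g)
    (hidlx : ∀ (T T' : Type) [CommRing T] [IsRegularLocalRing T] [CommRing T'] [IsRegularLocalRing T'] [Algebra T T']
      [IsLocalHom (algebraMap T T')] [Algebra.FormallySmooth T T'] [Algebra.EssFiniteType T T'] (g : T),
      ringKrullDim T = (3 : ℕ) → ringKrullDim T' = (3 : ℕ) → (maximalIdeal T).map (algebraMap T T') = maximalIdeal T' →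
      g ≠ 0 → g ∈ maximalIdeal T → ∀ (g₁' g₂' : T') (q r₁ r₂ : ℕ), IsTwoFlag g₁' g₂' → AdmissibleTriple q r₁ r₂ → q < r₂ →
      algebraMap T T' g ∈ flagContactFiltration g₁' g₂' q r₁ r₂ (r₁ * (adicOrder g).toNat) →
      (∀ q' r₁' r₂' : ℕ, AdmissibleTriple q' r₁' r₂' → FlagReaches (algebraMap T T' g) (adicOrder g).toNat q' r₁' r₂' →
        r₁' * r₂ ≤ r₁ * r₂') →
      ∃ J₁ J₂ : Ideal T, J₁.map (algebraMap T T') = flagContactFiltration g₁' g₂' q r₁ r₂ r₁ ∧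
        J₂.map (algebraMap T T') = flagContactFiltration g₁' g₂' q r₁ r₂ r₂)
    (hR6 : ∀ (T : Type) [CommRing T] [IsRegularLocalRing T] (f : T), ringKrullDim T = (3 : ℕ) → f ≠ 0 → f ∈ maximalIdeal T →
      ∀ q r₁ r₂ : ℕ, AdmissibleTriple q r₁ r₂ → FlagReaches f (adicOrder f).toNat q r₁ r₂ →
      ratioScale (adicOrder f).toNat * r₁ ≤ sigmaRatioNat f * r₂)
    (hgame : CanonicalGameClauseHomLE 3 p iotaFlatT jFlatT)
    (hres : ∀ (k₀ : Type) [Field k₀] [CharP k₀ p] [PerfectField k₀]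
      (S : Type) [CommRing S] [Algebra k₀ S] [Algebra.EssFiniteType k₀ S] [IsRegularLocalRing S] (f : S),
      ringKrullDim S = (3 : ℕ) → f ≠ 0 → f ∈ (maximalIdeal S) ^ 2 →
      ContactCylinder.topStratumPrime iotaOrdEpsTau S f = maximalIdeal S → iotaEps S f ≠ 1 →
      (∃ ℓ ∈ maximalIdeal S, f ∈ Ideal.span {ℓ ^ (adicOrder f).toNat} ⊔ maximalIdeal S ^ ((adicOrder f).toNat + 1)) →
      ∀ (a b : ℕ), 0 < b →
      (∀ q' r₁' r₂' : ℕ, AdmissibleTriple q' r₁' r₂' → FlagReaches f (adicOrder f).toNat q' r₁' r₂' → r₁' * b ≤ a * r₂') →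
      ∀ (g₁ g₂ g₁' g₂' : S) (q r₁ r₂ : ℕ), AdmissibleTriple q r₁ r₂ → r₁ * b = a * r₂ → q < r₂ → r₂ < r₁ →
        IsTwoFlag g₁ g₂ → IsTwoFlag g₁' g₂' →
        f ∈ flagContactFiltration g₁ g₂ q r₁ r₂ (r₁ * (adicOrder f).toNat) →
        f ∈ flagContactFiltration g₁' g₂' q r₁ r₂ (r₁ * (adicOrder f).toNat) →
        g₂' ∈ flagContactFiltration g₁ g₂ q r₁ r₂ r₂) :
    KeyRungGrHomLE 3 p :=
  keyRungGrHomLE_three_of_idealDescentExact3 p hD (idealDescent_letter_of_exact hidlx hR6) hidlx hgame hres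

end Summit.ResolutionOfSingularities.ResolutionOfSingularities.Cruxes.HypersurfaceCentreConstruction.LocalEngine

end
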